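import Summits.QuantumFields.YangMills.Theorems.AllWindowsColdBoxBoxHighLineFPChartWeightOnSmallField
import Summits.QuantumFields.YangMills.Theorems.AllWindowsColdBoxBoxHighLineRestrictionCov
import Summits.QuantumFields.YangMills.Theorems.AllWindowsColdBoxBoxHighLineSmearedFPOperatorFloor
import Summits.QuantumFields.YangMills.Theorems.AllWindowsColdBoxBoxHighLineSmearedFPOperatorPerturbation

/-!
# T-S5.13D «Gaussian normal form on D» — on the small-field box the FP-chart weight is a constant multiple of the tilted Gaussian, so every
# normalised FP-chart average / covariance on `D` IS the `t = 1` tilted Gaussian one (ASSEMBLY-S5 §5 Step D; LINE-19 S5 ⟨stmt-QuantumFields-24004⟩)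

LEAD sfw-p2 g77's T-S5.13 consumption list (2026-08-29T20:23:50Z) item **13D** («FREE after 5n-R/7e»), taken by the free-hands seat ym-line-fcl-p3 g26.
Letters: `D = smallField H s`, `w_J = fpChartWeight β H r` (✓`…Step2Defs`), `tiltU β H` (✓`…Step2Tilt`),
`ν_J := (volume.restrict D).withDensity (ofReal ∘ w_J)` (the FP-chart measure on `D`, 13A's output currency) and
`μ_D := (volume.restrict D).withDensity (ofReal ∘ gaussWeight β H)` (the assembler's restricted Gaussian) — all written out in full, no definitions.

* §1 generic (ns `…Tilt`): for a measurable weight `w ≥ 0`, `∫ G d(μ.withDensity (ofReal ∘ w)) = ∫ G·w dμ` and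
  ★`tiltExp_withDensity_ofReal` `Tilt.tiltExp (μ.withDensity (ofReal ∘ w)) U t G = (∫ G·e^{tU}·w dμ)/(∫ e^{tU}·w dμ)` (every `t`; at `t = 0`: `(∫ G w)/(∫ w)`).
* §2 (ns `…GaussNormalForm`), hypotheses `1 ≤ H`, `0 ≤ s ≤ r`, `s < π`, `0 < r`, `hdet : ∀ a ∈ D, det F_FP(U(a)) ≠ 0` (all of ASSEMBLY §1 (F5)/(F7)):
  `setIntegral_mul_fpChartWeight_eq` (`∫_D G·w_J = K·∫_D G·e^{1·tiltU}·gaussWeight`, `K = |det F₁|·σ(0)^n ≠ 0`, ✓5n-R `fpChartWeight_eq_on_smallField`),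
  ★★`tiltExp_fpChart_eq` (`Tilt.tiltExp ν_J U′ 0 G = Tilt.tiltExp μ_D (tiltU β H) 1 G` for EVERY `G` and `U′` — the constant cancels),
  ★`tiltCov_fpChart_eq`, and the quotient forms ★`setIntegral_fpChartWeight_div_eq` (`(∫_D G·w_J)/(∫_D w_J) = Tilt.tiltExp μ_D (tiltU β H) 1 G`),
  `cov_fpChartWeight_eq` (the same for covariances) — so 13A's `Cov_{D,J}(c₀,c_T)` in either currency equals `f(1) = Tilt.tiltCov μ_D (tiltU β H) 1 c₀ c_T`
  of ASSEMBLY §6, while `f(0) = Tilt.tiltCov μ_D (tiltU β H) 0 · ·` is handled by ✓13r (`GaussRestrict.abs_gaussCov_sub_tiltCov_restrict_le` +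
  `GaussRestrict.restrict_smallField_eq`);
* §3 hygiene for the assembler's `μ_D` in its literal letters: `muD_eq_restrict` (`μ_D = μ_G.restrict D`, so ✓13r applies verbatim), `neZero_muD` (`s > 0`), `integral_muD_eq`
  (set-integral form; w5's ✓`Tilt.integral_muD_eq` is the indicator form), `tiltExp_muD_eq` (finiteness: w5's ✓`Tilt.isFiniteMeasure_muD`).
* §4 ★`det_fpOperator_edgeChart_ne_zero` — the hypothesis `hdet` DISCHARGED on `smallField H s` whenever `0 ≤ s ≤ 1` and `252·s < (1/4)/H²` (ASSEMBLY (F7)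
  «det F(U(a)) ≠ 0 on D, ✓4c-E/4f with sH² ≪ 1»: ✓`fpOperator_sub_one_opBound_of_linkDefect` + ✓`SpectralFloor.fpOperator_inv_of_sub_one` + ✓`FPChart.linkDefect_edgeChart_le`).

Mathlib + tree (✓FPChartWeightOnSmallField, ✓RestrictionCov, ✓SmearedFPOperatorFloor/Perturbation); no definitions.  HONEST LABEL: plumbing for the T-S5.13 assembly of the XL stub S5 of a critic-PASSed DRAFT
line; S5, U5, ⟨24004⟩ ⟨24335⟩ ⟨24336⟩ remain OPEN; route AllWindowsColdBox is DRAFT; no rung is proved; **the Yang–Mills mass gap is NOT proved by this file; no summit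
is proved by a line.**  Seat ym-line-fcl-p3 g26 (cell ym-idea-1).
-/

set_option autoImplicit false

noncomputable section

open MeasureTheory Set
open Literature.MathematicalPhysics.QuantumFieldTheory.Balaban1983to89.B10Eq22Rescaling (sigmaSU2)
open Literature.MathematicalPhysics.QuantumFieldTheory.AxialGauge (boxEdges)

namespace Summit.QuantumFields.YangMills.Theorems.AllWindowsColdBoxBoxHighLine

/-! ## §1 Tilted expectations of a `withDensity (ofReal ∘ w)` measure -/

namespace Tilt

variable {Ω : Type*} [MeasurableSpace Ω]

/-- `∫ G d(μ.withDensity (ofReal ∘ w)) = ∫ G·w dμ` for a measurable weight `w ≥ 0` (every `G`). -/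
theorem integral_withDensity_ofReal_eq (μ : Measure Ω) {w : Ω → ℝ} (hw : Measurable w) (hw0 : ∀ x, 0 ≤ w x) (G : Ω → ℝ) :
    ∫ x, G x ∂(μ.withDensity fun x => ENNReal.ofReal (w x)) = ∫ x, G x * w x ∂μ := by
  rw [integral_withDensity_eq_integral_toReal_smul hw.ennreal_ofReal (Filter.Eventually.of_forall fun _ => ENNReal.ofReal_lt_top)]
  refine integral_congr_ae (Filter.Eventually.of_forall fun x => ?_)
  simp only [ENNReal.toReal_ofReal (hw0 x), smul_eq_mul, mul_comm]

/-- ★ **Tilted expectations under a density**: `tiltExp (μ.withDensity (ofReal ∘ w)) U t G = (∫ G·e^{tU}·w dμ)/(∫ e^{tU}·w dμ)`. -/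
theorem tiltExp_withDensity_ofReal (μ : Measure Ω) {w : Ω → ℝ} (hw : Measurable w) (hw0 : ∀ x, 0 ≤ w x) (U : Ω → ℝ) (t : ℝ) (G : Ω → ℝ) :
    tiltExp (μ.withDensity fun x => ENNReal.ofReal (w x)) U t G =
      (∫ x, G x * Real.exp (t * U x) * w x ∂μ) / ∫ x, Real.exp (t * U x) * w x ∂μ := by
  rw [tiltExp, integral_withDensity_ofReal_eq μ hw hw0, integral_withDensity_ofReal_eq μ hw hw0]

/-- At `t = 0`: `tiltExp (μ.withDensity (ofReal ∘ w)) U 0 G = (∫ G·w dμ)/(∫ w dμ)`. -/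
theorem tiltExp_withDensity_ofReal_zero (μ : Measure Ω) {w : Ω → ℝ} (hw : Measurable w) (hw0 : ∀ x, 0 ≤ w x) (U : Ω → ℝ) (G : Ω → ℝ) :
    tiltExp (μ.withDensity fun x => ENNReal.ofReal (w x)) U 0 G = (∫ x, G x * w x ∂μ) / ∫ x, w x ∂μ := by
  rw [tiltExp_withDensity_ofReal μ hw hw0]
  simp only [zero_mul, Real.exp_zero, mul_one, one_mul]

end Tilt

/-! ## §2 The FP-chart weight on the small-field box -/

namespace GaussNormalForm

open EdgeChartGaussian (gaussWeight_pos aestronglyMeasurable_gaussWeight integrable_gaussWeight)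

variable {H : ℕ} {β r s : ℝ}

/-- The constant `K = |det F_FP(1)|·σ(0)^{|LandauFree H|}` is nonzero. -/
theorem const_ne_zero (H : ℕ) : |(fpOperator H 1).det| * sigmaSU2 0 ^ Fintype.card (LandauFree H) ≠ 0 :=
  mul_ne_zero (abs_ne_zero.2 (det_fpOperator_one_ne_zero H)) (FPChartFactor.sigmaSU2_zero_pow_ne_zero H)

/-- `gaussWeight` is measurable (it is continuous in the flat coordinates; here from ✓`aestronglyMeasurable_gaussWeight` is not enough, so we prove it:
`a ↦ exp(−β·boxQuadForm H a)` is a composition of a polynomial map with `exp`). -/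
theorem measurable_gaussWeight (β : ℝ) (H : ℕ) : Measurable (gaussWeight β H) := by
  unfold gaussWeight boxQuadForm colour
  refine Real.measurable_exp.comp (Measurable.neg (Measurable.const_mul ?_ β))
  refine Finset.measurable_sum _ fun c _ => ?_
  unfold dotProduct Matrix.mulVec
  refine Finset.measurable_sum _ fun e _ => Measurable.mul (EdgeChartGaussian.measurable_coord e c) ?_
  refine Finset.measurable_sum _ fun e' _ => Measurable.mul measurable_const (EdgeChartGaussian.measurable_coord e' c)

/-- ★ **On `D` the FP-chart weight integrates like `K` times the `t = 1` tilted Gaussian**: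
`∫_D G·w_J = K · ∫_D G·e^{tiltU}·gaussWeight` for every `G` (✓5n-R pointwise on `D`). -/
theorem setIntegral_mul_fpChartWeight_eq (hH : 1 ≤ H) (hs0 : 0 ≤ s) (hsr : s ≤ r) (hsπ : s < Real.pi) (hr : 0 < r)
    (hdet : ∀ a ∈ smallField H s, (fpOperator H (edgeChart H a)).det ≠ 0) (G : (LandauFree H → E3) → ℝ) :
    ∫ a in smallField H s, G a * fpChartWeight β H r a =
      (|(fpOperator H 1).det| * sigmaSU2 0 ^ Fintype.card (LandauFree H)) *
        ∫ a in smallField H s, G a * Real.exp (tiltU β H a) * gaussWeight β H a := by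
  rw [← integral_const_mul]
  refine setIntegral_congr_fun (ChartGauss.measurableSet_smallField s) fun a ha => ?_
  rw [fpChartWeight_eq_on_smallField hH hs0 hsr hsπ hr ha (hdet a ha)]
  ring

/-- ★★ **T-S5.13D**: every normalised FP-chart average on `D` is the `t = 1` tilted Gaussian average —
`Tilt.tiltExp ν_J U′ 0 G = Tilt.tiltExp μ_D (tiltU β H) 1 G` (every `G`, every dummy `U′`; the constant `K` cancels). -/
theorem tiltExp_fpChart_eq (hH : 1 ≤ H) (hs0 : 0 ≤ s) (hsr : s ≤ r) (hsπ : s < Real.pi) (hr : 0 < r)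
    (hdet : ∀ a ∈ smallField H s, (fpOperator H (edgeChart H a)).det ≠ 0) (U' G : (LandauFree H → E3) → ℝ) :
    Tilt.tiltExp (((volume : Measure (LandauFree H → E3)).restrict (smallField H s)).withDensity fun a => ENNReal.ofReal (fpChartWeight β H r a)) U' 0 G =
      Tilt.tiltExp (((volume : Measure (LandauFree H → E3)).restrict (smallField H s)).withDensity fun a => ENNReal.ofReal (gaussWeight β H a))
        (tiltU β H) 1 G := by
  rw [Tilt.tiltExp_withDensity_ofReal_zero _ (FPChart.measurable_fpChartWeight β H r) (FPChart.fpChartWeight_nonneg β r),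
    Tilt.tiltExp_withDensity_ofReal _ (measurable_gaussWeight β H) (fun a => (gaussWeight_pos β H a).le)]
  simp only [one_mul]
  rw [setIntegral_mul_fpChartWeight_eq hH hs0 hsr hsπ hr hdet G]
  have h1 := setIntegral_mul_fpChartWeight_eq (β := β) hH hs0 hsr hsπ hr hdet (fun _ => (1 : ℝ))
  simp only [one_mul] at h1
  rw [h1, mul_div_mul_left _ _ (const_ne_zero H)]

/-- ★ The same for covariances: `Tilt.tiltCov ν_J U′ 0 F G = Tilt.tiltCov μ_D (tiltU β H) 1 F G`. -/
theorem tiltCov_fpChart_eq (hH : 1 ≤ H) (hs0 : 0 ≤ s) (hsr : s ≤ r) (hsπ : s < Real.pi) (hr : 0 < r)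
    (hdet : ∀ a ∈ smallField H s, (fpOperator H (edgeChart H a)).det ≠ 0) (U' F G : (LandauFree H → E3) → ℝ) :
    Tilt.tiltCov (((volume : Measure (LandauFree H → E3)).restrict (smallField H s)).withDensity fun a => ENNReal.ofReal (fpChartWeight β H r a)) U' 0 F G =
      Tilt.tiltCov (((volume : Measure (LandauFree H → E3)).restrict (smallField H s)).withDensity fun a => ENNReal.ofReal (gaussWeight β H a))
        (tiltU β H) 1 F G := by
  simp only [Tilt.tiltCov, tiltExp_fpChart_eq hH hs0 hsr hsπ hr hdet]

/-- ★ Quotient currency: `(∫_D G·w_J)/(∫_D w_J) = Tilt.tiltExp μ_D (tiltU β H) 1 G`. -/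
theorem setIntegral_fpChartWeight_div_eq (hH : 1 ≤ H) (hs0 : 0 ≤ s) (hsr : s ≤ r) (hsπ : s < Real.pi) (hr : 0 < r)
    (hdet : ∀ a ∈ smallField H s, (fpOperator H (edgeChart H a)).det ≠ 0) (G : (LandauFree H → E3) → ℝ) :
    (∫ a in smallField H s, G a * fpChartWeight β H r a) / (∫ a in smallField H s, fpChartWeight β H r a) =
      Tilt.tiltExp (((volume : Measure (LandauFree H → E3)).restrict (smallField H s)).withDensity fun a => ENNReal.ofReal (gaussWeight β H a))
        (tiltU β H) 1 G := by
  rw [← tiltExp_fpChart_eq hH hs0 hsr hsπ hr hdet (fun _ => 0) G,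
    Tilt.tiltExp_withDensity_ofReal_zero _ (FPChart.measurable_fpChartWeight β H r) (FPChart.fpChartWeight_nonneg β r)]

/-- Quotient currency for covariances: `Cov_{D,J}(F,G) = Tilt.tiltCov μ_D (tiltU β H) 1 F G`. -/
theorem cov_fpChartWeight_eq (hH : 1 ≤ H) (hs0 : 0 ≤ s) (hsr : s ≤ r) (hsπ : s < Real.pi) (hr : 0 < r)
    (hdet : ∀ a ∈ smallField H s, (fpOperator H (edgeChart H a)).det ≠ 0) (F G : (LandauFree H → E3) → ℝ) :
    (∫ a in smallField H s, F a * G a * fpChartWeight β H r a) / (∫ a in smallField H s, fpChartWeight β H r a) -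
        (∫ a in smallField H s, F a * fpChartWeight β H r a) / (∫ a in smallField H s, fpChartWeight β H r a) *
          ((∫ a in smallField H s, G a * fpChartWeight β H r a) / (∫ a in smallField H s, fpChartWeight β H r a)) =
      Tilt.tiltCov (((volume : Measure (LandauFree H → E3)).restrict (smallField H s)).withDensity fun a => ENNReal.ofReal (gaussWeight β H a))
        (tiltU β H) 1 F G := by
  rw [Tilt.tiltCov, ← setIntegral_fpChartWeight_div_eq hH hs0 hsr hsπ hr hdet (fun a => F a * G a),
    ← setIntegral_fpChartWeight_div_eq hH hs0 hsr hsπ hr hdet F, ← setIntegral_fpChartWeight_div_eq hH hs0 hsr hsπ hr hdet G]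

/-! ## §3 The assembler's `μ_D` in its literal letters -/

/-- `μ_D = μ_G.restrict D` (✓`GaussRestrict.restrict_smallField_eq`, reversed). -/
theorem muD_eq_restrict (β : ℝ) (H : ℕ) (s : ℝ) :
    (((volume : Measure (LandauFree H → E3)).restrict (smallField H s)).withDensity fun a => ENNReal.ofReal (gaussWeight β H a)) =
      ((volume : Measure (LandauFree H → E3)).withDensity fun a => ENNReal.ofReal (gaussWeight β H a)).restrict (smallField H s) :=
  (GaussRestrict.restrict_smallField_eq H β s).symm

/-- `μ_D ≠ 0` for `s > 0` (`β > 0`). -/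
theorem neZero_muD (hβ : 0 < β) (hs : 0 < s) :
    NeZero (((volume : Measure (LandauFree H → E3)).restrict (smallField H s)).withDensity fun a => ENNReal.ofReal (gaussWeight β H a)) := by
  rw [muD_eq_restrict]
  exact GaussRestrict.neZero_restrict_smallField H hβ hs

/-- `∫ G dμ_D = ∫_D G·gaussWeight` (every `G`). -/
theorem integral_muD_eq (β : ℝ) (s : ℝ) (G : (LandauFree H → E3) → ℝ) :
    ∫ a, G a ∂(((volume : Measure (LandauFree H → E3)).restrict (smallField H s)).withDensity fun a => ENNReal.ofReal (gaussWeight β H a)) =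
      ∫ a in smallField H s, G a * gaussWeight β H a :=
  Tilt.integral_withDensity_ofReal_eq _ (measurable_gaussWeight β H) (fun a => (gaussWeight_pos β H a).le) G

/-- `tiltExp μ_D U t G = (∫_D G e^{tU} gaussWeight)/(∫_D e^{tU} gaussWeight)` — the `E₀[1_D · ]`-quotient form of ASSEMBLY §6. -/
theorem tiltExp_muD_eq (β : ℝ) (s : ℝ) (U : (LandauFree H → E3) → ℝ) (t : ℝ) (G : (LandauFree H → E3) → ℝ) :
    Tilt.tiltExp (((volume : Measure (LandauFree H → E3)).restrict (smallField H s)).withDensity fun a => ENNReal.ofReal (gaussWeight β H a)) U t G =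
      (∫ a in smallField H s, G a * Real.exp (t * U a) * gaussWeight β H a) / ∫ a in smallField H s, Real.exp (t * U a) * gaussWeight β H a :=
  Tilt.tiltExp_withDensity_ofReal _ (measurable_gaussWeight β H) (fun a => (gaussWeight_pos β H a).le) U t G

/-! ## §4 Discharging `hdet`: the FP operator of the chart is invertible on small fields with `s·H² ≪ 1` -/

/-- On `smallField H s` with `s ≤ 1` every cold-box link of the chart has defect `≤ s²` (✓`FPChart.linkDefect_edgeChart_le`). -/
theorem linkDefect_edgeChart_le_sq (hs1 : s ≤ 1) {a : LandauFree H → E3} (ha : a ∈ smallField H s) :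
    ∀ e ∈ boxEdges 4 (2 * H + 1), linkDefect (edgeChart H a) e ≤ s ^ 2 := by
  intro E hE
  let e : LandauFree H := ⟨⟨E, mem_boxEdgesAt_of_mem_boxEdges hE⟩, not_not_intro hE⟩
  have hπ : ‖a e‖ ≤ Real.pi := ((ha e).trans hs1).trans (by linarith [Real.pi_gt_three])
  calc linkDefect (edgeChart H a) E = linkDefect (edgeChart H a) e.1.1 := rfl
    _ ≤ ‖a e‖ ^ 2 := FPChart.linkDefect_edgeChart_le a e hπ
    _ ≤ s ^ 2 := pow_le_pow_left₀ (norm_nonneg _) (ha e) 2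

/-- ★ **`hdet` discharged**: for `H ≥ 1`, `0 ≤ s ≤ 1`, `252·s < (1/4)/H²`, `det F_FP(U(a)) ≠ 0` for every `a ∈ smallField H s`
(✓`fpOperator_sub_one_opBound_of_linkDefect` with `r = s`, ✓`SpectralFloor.fpOperator_inv_of_sub_one` with `m = 252·s`). -/
theorem det_fpOperator_edgeChart_ne_zero (hH : 1 ≤ H) (hs0 : 0 ≤ s) (hs1 : s ≤ 1) (hsH : 252 * s < 1 / 4 / (H : ℝ) ^ 2) :
    ∀ a ∈ smallField H s, (fpOperator H (edgeChart H a)).det ≠ 0 := fun a ha =>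
  (SpectralFloor.fpOperator_inv_of_sub_one hH (edgeChart H a) (by positivity) hsH
    (fpOperator_sub_one_opBound_of_linkDefect (edgeChart H a) hs0 hs1 (linkDefect_edgeChart_le_sq hs1 ha))).1.ne_zero

end GaussNormalForm

end Summit.QuantumFields.YangMills.Theorems.AllWindowsColdBoxBoxHighLine

end
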